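import Literature.AlgebraicGeometry.Motives.CyclesDivisorDimensionProofs
import Literature.AlgebraicGeometry.Motives.ClosedSubvarietyOfPoint
import Mathlib.RingTheory.Ideal.KrullsHeightTheorem
import Mathlib.RingTheory.Ideal.MinimalPrime.Noetherian
import HarnessLib

/-!
# Curves through a closed point of a variety leaving a proper closed subset

For an integral scheme `X` locally of finite type over a field `K`, of finite dimension `d ≥ 1`
(`Order.height` of the generic point, the grading of `Motives/Cycles`):

* `exists_isPrime_height_eq_one_le_not_le` — commutative algebra: in a noetherian domain, below a
  prime `𝔪` of height `≥ 2` there is a height-one prime `𝔮 ⊆ 𝔪` not containing a given nonzero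
  ideal `I` (prime avoidance and Krull's principal ideal theorem, Mathlib
  `Ideal.subset_union_prime_finite`, `Ideal.height_le_one_of_isPrincipal_of_mem_minimalPrimes`);
* `exists_coheight_eq_one_specializes_notMem` — for `d ≥ 2`, a closed point `P` and a closed
  `F ⊆ X` not containing the generic point, some codimension-one point specialises to `P` and is not
  in `F` (the previous lemma in an affine chart, with the dimension formula
  `dim 𝒪_{X,P} = d`, `Scheme.height_add_coheight_eq_height_top` of `Motives/CyclesDivisorDimensionProofs`);
* `exists_height_eq_one_specializes_notMem` — by induction on `d`, cutting down along
  `closure {y₁}` (`ClosedSubvariety.ofPoint`): **some point of dimension one specialises to `P` and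
  is not in `F`**, i.e. through `P` passes an integral closed curve not contained in `F`;
* `exists_closedSubvariety_dim_eq_one_apply_ne` — the form used downstream: if a continuous map
  `φ : X → Y` to a `T₀`-space (e.g. a morphism of schemes) takes at some point a value different from
  its generic value, then `φ` is non-constant on some closed subvariety `W ⊆ X` of dimension one.

This is the one-point version of the classical lemma that any two points of a variety lie on an
irreducible curve (whose usual proof needs Bertini's theorem); prescribing only one point and an
avoided closed subset makes prime avoidance suffice. It supplies the test curves for the positive
quadratic forms on `Hom(A, B)` of abelian varieties (`Motives/AbelianVarietyHomCurveForm`). Also: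
`Order.exists_isMin_le_of_height_lt_top` (a point of finite height specialises to a closed point).

Mathlib searched (pin): `Ideal.subset_union_prime_finite`, `Ideal.exists_minimalPrimes_le`,
`Ideal.finite_minimalPrimes_of_isNoetherianRing`, `Ideal.height_le_one_of_isPrincipal_of_mem_minimalPrimes`,
`Ideal.height_strict_mono_of_isPrime_of_isPrime`, `idealHeight_eq_coheight`,
`coheight_eq_of_isOpenImmersion`, `Order.height_strictMono` (all used); no statement about curves
through points of varieties exists in Mathlib.

## References

* U. Görtz, T. Wedhorn, *Algebraic Geometry I: Schemes*, 2nd ed. (2020): Thm. 5.22 and Prop. 5.30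
  (dimension of varieties and of their local rings; used through `Motives/CyclesDivisorDimensionProofs`).
  [GortzWedhorn2020]
* H. Matsumura, *Commutative Ring Theory* (1986): Thm. 13.5 (Krull's principal ideal theorem), used
  through Mathlib. [Matsumura1987]
-/

universe u

open CategoryTheory AlgebraicGeometry Order Topology TopologicalSpace

namespace Literature.AlgebraicGeometry.Motives

/-! ### Commutative algebra: a height-one prime below `𝔪` avoiding `V(I)` -/

/-- **A height-one prime inside a prime of height `≥ 2` and not containing a given nonzero ideal.**
Let `A` be a noetherian domain, `𝔪 ⊂ A` a prime ideal of height `≥ 2` and `I ≠ 0` an ideal. Then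
there is a prime `𝔮 ⊆ 𝔪` of height one with `I ⊄ 𝔮`. Proof: by prime avoidance pick
`h ∈ 𝔪 ∖ {0}` outside the finitely many minimal primes of `I` of height `≤ 1`; a minimal prime `𝔮`
of `(h)` inside `𝔪` has height one (Krull's principal ideal theorem), and `I ⊆ 𝔮` would force `𝔮` to
be one of the avoided primes. [folklore] -/
theorem exists_isPrime_height_eq_one_le_not_le {A : Type*} [CommRing A] [IsDomain A]
    [IsNoetherianRing A] (𝔪 : Ideal A) [𝔪.IsPrime] (h𝔪 : 2 ≤ 𝔪.height) {I : Ideal A}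
    (hI : I ≠ ⊥) : ∃ 𝔮 : Ideal A, 𝔮.IsPrime ∧ 𝔮.height = 1 ∧ 𝔮 ≤ 𝔪 ∧ ¬ I ≤ 𝔮 := by
  classical
  -- the primes to avoid: minimal primes of `I` of height `≤ 1`, and `⊥`
  let S : Set (Ideal A) := {p | p ∈ I.minimalPrimes ∧ p.height ≤ 1} ∪ {⊥}
  have hSfin : S.Finite :=
    ((Ideal.finite_minimalPrimes_of_isNoetherianRing A I).subset fun p hp => hp.1).union
      (Set.finite_singleton _)
  have hSprime : ∀ p ∈ S, p ≠ ⊥ → p ≠ ⊥ → p.IsPrime := by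
    rintro p (hp | hp) h1 -
    · exact hp.1.1.1
    · exact absurd hp h1
  have h𝔪S : ¬ ((𝔪 : Set A) ⊆ ⋃ p ∈ S, (p : Set A)) := by
    rw [Ideal.subset_union_prime_finite hSfin ⊥ ⊥ hSprime]
    rintro ⟨p, hp | hp, h𝔪p⟩
    · have h1 : 𝔪.height ≤ 1 := (Ideal.height_mono h𝔪p).trans hp.2
      have : (2 : ℕ∞) ≤ 1 := h𝔪.trans h1
      exact absurd this (by decide)
    · rw [Set.mem_singleton_iff] at hp
      subst hp
      have h0 : 𝔪 = ⊥ := le_bot_iff.mp h𝔪p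
      have : 𝔪.height = 0 := by rw [h0]; exact Ideal.height_bot
      rw [this] at h𝔪
      exact absurd h𝔪 (by decide)
  obtain ⟨h, hh𝔪, hhS⟩ := Set.not_subset.mp h𝔪S
  simp only [Set.mem_iUnion, SetLike.mem_coe, exists_prop, not_exists, not_and] at hhS
  have hh0 : h ≠ 0 := fun hh0 => hhS ⊥ (Or.inr rfl) (by rw [hh0]; exact Submodule.zero_mem _)
  -- a minimal prime `𝔮` of `(h)` inside `𝔪`
  obtain ⟨𝔮, h𝔮min, h𝔮𝔪⟩ :=
    Ideal.exists_minimalPrimes_le (I := Ideal.span {h}) ((Ideal.span_singleton_le_iff_mem _).mpr hh𝔪)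
  haveI h𝔮p : 𝔮.IsPrime := h𝔮min.1.1
  have hh𝔮 : h ∈ 𝔮 := h𝔮min.1.2 (Ideal.subset_span (Set.mem_singleton h))
  have h𝔮1 : 𝔮.height = 1 := by
    apply le_antisymm (Ideal.height_le_one_of_isPrincipal_of_mem_minimalPrimes _ 𝔮 h𝔮min)
    rw [Order.one_le_iff_ne_zero, Ne, Ideal.height_eq_zero_iff_eq_bot]
    rintro rfl
    exact hh0 ((Submodule.mem_bot A).mp hh𝔮)
  refine ⟨𝔮, h𝔮p, h𝔮1, h𝔮𝔪, fun hI𝔮 => ?_⟩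
  -- if `I ≤ 𝔮`, a minimal prime `p ≤ 𝔮` of `I` has height `≤ 1`, hence was avoided; but `p = 𝔮 ∋ h`
  obtain ⟨p, hpmin, hp𝔮⟩ := Ideal.exists_minimalPrimes_le hI𝔮
  haveI hpp : p.IsPrime := hpmin.1.1
  have hp1 : p.height ≤ 1 := (Ideal.height_mono hp𝔮).trans h𝔮1.le
  have hpeq : p = 𝔮 := by
    by_contra hne
    have hlt : p < 𝔮 := lt_of_le_of_ne hp𝔮 hne
    haveI : 𝔮.FiniteHeight := 𝔮.finiteHeight_iff.mpr (Or.inr (by rw [h𝔮1]; exact ENat.one_ne_top))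
    have h2 := Ideal.height_strict_mono_of_isPrime_of_isPrime hlt
    rw [h𝔮1, Order.lt_one_iff, Ideal.height_eq_zero_iff_eq_bot] at h2
    subst h2
    exact hI (le_bot_iff.mp hpmin.1.2)
  exact hhS p (Or.inl ⟨hpmin, hp1⟩) (hpeq ▸ hh𝔮)


/-! ### Points of codimension one specialising to a closed point and leaving a closed subset -/

section Scheme

variable {K : Type u} [Field K] {X : Scheme.{u}} [IsIntegral X] (f : X ⟶ Spec (.of K))
  [LocallyOfFiniteType f]

include f in
/-- **Induction step.** On an integral scheme `X` locally of finite type over a field, of dimension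
`d ≥ 2`, let `F ⊊ X` be a proper closed subset and `P` a closed point. Then some point `y` of
codimension one specialises to `P` without lying in `F` (in an affine chart `Spec A ∋ P`: a
height-one prime `𝔮 ⊆ 𝔪_P` not containing the ideal of `F`,
`exists_isPrime_height_eq_one_le_not_le`, `dim A_{𝔪_P} = d ≥ 2`). [folklore] -/
theorem exists_coheight_eq_one_specializes_notMem {d : ℕ} (hd : height (⊤ : X) = d) (h2 : 2 ≤ d)
    {F : Set X} (hF : IsClosed F) (htop : (⊤ : X) ∉ F) {P : X} (hP : height P = 0) :
    ∃ y : X, coheight y = 1 ∧ y ⤳ P ∧ y ∉ F := by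
  haveI : IsLocallyNoetherian X := LocallyOfFiniteType.isLocallyNoetherian f
  -- an affine chart around `P`
  obtain ⟨_, ⟨U, hU, rfl⟩, hPU, -⟩ :=
    X.isBasis_affineOpens.exists_subset_of_mem_open (Set.mem_univ P) isOpen_univ
  have hU : IsAffineOpen U := hU
  haveI : Nonempty U := ⟨⟨P, hPU⟩⟩
  haveI : IsNoetherianRing Γ(X, U) := IsLocallyNoetherian.component_noetherian ⟨U, hU⟩
  -- the prime `𝔪` of `P` has height `coheight P = d ≥ 2`
  set 𝔪 := hU.primeIdealOf ⟨P, hPU⟩ with h𝔪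
  have hcoP : coheight P = d := by
    have h := Scheme.height_add_coheight_eq_height_top f P
    rwa [hP, hd, zero_add] at h
  have h𝔪ht : (2 : ℕ∞) ≤ 𝔪.asIdeal.height := by
    have e : (𝔪.asIdeal.height : ℕ∞) = coheight P := by
      rw [idealHeight_eq_coheight, ← coheight_eq_of_isOpenImmersion hU.fromSpec, h𝔪,
        hU.fromSpec_primeIdealOf]
    rw [e, hcoP]
    exact_mod_cast h2
  -- the ideal `I` of the closed subset `F ∩ U` of the chart, nonzero since `η ∉ F`
  set Z : Set (PrimeSpectrum Γ(X, U)) := hU.fromSpec.base ⁻¹' F with hZ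
  have hZc : IsClosed Z := hF.preimage hU.fromSpec.continuous
  set I : Ideal Γ(X, U) := PrimeSpectrum.vanishingIdeal Z with hI
  have hZI : PrimeSpectrum.zeroLocus (I : Set Γ(X, U)) = Z := by
    rw [hI, PrimeSpectrum.zeroLocus_vanishingIdeal_eq_closure, hZc.closure_eq]
  have hUtop : (⊤ : X) ∈ U := (Scheme.le_iff_specializes.mp (le_top (a := P))).mem_open U.2 hPU
  have hI0 : I ≠ ⊥ := by
    intro hI0
    have hξ : hU.primeIdealOf ⟨⊤, hUtop⟩ ∈ Z := by
      rw [← hZI, hI0]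
      simp
    rw [hZ, Set.mem_preimage, hU.fromSpec_primeIdealOf] at hξ
    exact htop hξ
  -- a height-one prime `𝔮 ⊆ 𝔪` with `I ⊄ 𝔮`
  obtain ⟨𝔮, h𝔮p, h𝔮1, h𝔮𝔪, hI𝔮⟩ := exists_isPrime_height_eq_one_le_not_le 𝔪.asIdeal h𝔪ht hI0
  let q : PrimeSpectrum Γ(X, U) := ⟨𝔮, h𝔮p⟩
  refine ⟨hU.fromSpec.base q, ?_, ?_, ?_⟩
  · rw [coheight_eq_of_isOpenImmersion hU.fromSpec, ← idealHeight_eq_coheight]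
    exact h𝔮1
  · have h := (Dimension.Scheme.fromSpec_specializes_iff hU q 𝔪).mpr h𝔮𝔪
    rwa [h𝔪, hU.fromSpec_primeIdealOf] at h
  · intro hq
    have hqZ : q ∈ Z := hq
    have hqI : q ∈ PrimeSpectrum.zeroLocus (I : Set Γ(X, U)) := by rw [hZI]; exact hqZ
    rw [PrimeSpectrum.mem_zeroLocus, SetLike.coe_subset_coe] at hqI
    exact hI𝔮 hqI

/-- **Through every closed point of an integral positive-dimensional variety passes a curve leaving
any given proper closed subset**, pointwise form: for `X` integral, locally of finite type over a
field, of dimension `d ≥ 1`, `F ⊊ X` closed with `η_X ∉ F` and `P` a closed point, there is a point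
`y` of dimension one (`dim closure {y} = 1`) specialising to `P` and not lying in `F`. Induction on
`d`: for `d = 1` take `y = η_X`; for `d ≥ 2` cut down to the closed subvariety `closure {y₁}` of
dimension `d - 1` through `P` with `y₁ ∉ F` (`exists_coheight_eq_one_specializes_notMem`).
(One-point version of "any two points of a variety lie on a curve"; prescribing one point only
avoids Bertini's theorem.) [folklore] -/
theorem exists_height_eq_one_specializes_notMem :
    ∀ (d : ℕ), 1 ≤ d → ∀ {X : Scheme.{u}} [IsIntegral X] (f : X ⟶ Spec (.of K))
      [LocallyOfFiniteType f], height (⊤ : X) = d → ∀ {F : Set X}, IsClosed F → (⊤ : X) ∉ F →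
      ∀ {P : X}, height P = 0 → ∃ y : X, height y = 1 ∧ y ⤳ P ∧ y ∉ F := by
  intro d hd
  induction d, hd using Nat.le_induction with
  | base =>
    intro X _ f _ hX F _ htop P _
    exact ⟨⊤, by rw [hX]; rfl, Scheme.le_iff_specializes.mp le_top, htop⟩
  | succ d hd ih =>
    intro X _ f _ hX F hF htop P hP
    obtain ⟨y₁, hy₁, hy₁P, hy₁F⟩ :=
      exists_coheight_eq_one_specializes_notMem f hX (by omega) hF htop hP
    have hy₁d : height y₁ = d :=
      Scheme.height_eq_of_coheight_eq f (m := d + 1) (p := 1) (e := d) hX hy₁ rfl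
    -- cut down to `X₁ = closure {y₁}`
    let X₁ := ClosedSubvariety.ofPoint X y₁
    have hX₁ : height (⊤ : X₁.carrier) = d := by
      rw [← ClosedSubvariety.dim_eq_height_top, ClosedSubvariety.dim_ofPoint, hy₁d]
    have htop₁ : (⊤ : X₁.carrier) ∉ X₁.ι.base ⁻¹' F := by
      change X₁.genericPoint ∉ F
      rw [ClosedSubvariety.genericPoint_ofPoint]
      exact hy₁F
    let P₁ : X₁.carrier := ClosedSubvariety.ofPointPt y₁ hy₁P
    have hP₁ : height P₁ = 0 := by
      rw [← ClosedSubvariety.height_ι_base]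
      exact hP
    obtain ⟨y, hy, hyP, hyF⟩ :=
      ih (X₁.ι ≫ f) hX₁ (hF.preimage X₁.ι.continuous) htop₁ hP₁
    refine ⟨X₁.ι.base y, by rw [ClosedSubvariety.height_ι_base]; exact hy, ?_, hyF⟩
    exact hyP.map X₁.ι.continuous

/-- Below a point of finite height there is a minimal point (a closed point, for schemes).
[folklore] -/
theorem _root_.Order.exists_isMin_le_of_height_lt_top {α : Type*} [Preorder α] {x : α}
    (hx : height x < ⊤) : ∃ m : α, m ≤ x ∧ IsMin m := by
  obtain ⟨n, hn⟩ := WithTop.ne_top_iff_exists.mp hx.ne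
  induction n using Nat.strong_induction_on generalizing x with
  | _ n ih =>
    by_cases hmin : IsMin x
    · exact ⟨x, le_rfl, hmin⟩
    · obtain ⟨w, hw⟩ := not_isMin_iff.mp hmin
      have hlt : height w < height x := Order.height_strictMono hw ((Order.height_mono hw.le).trans_lt hx)
      rw [← hn] at hlt
      obtain ⟨k, hk⟩ := WithTop.ne_top_iff_exists.mp (hlt.trans (WithTop.coe_lt_top n)).ne
      rw [← hk] at hlt
      obtain ⟨m, hm, hmmin⟩ := ih k (WithTop.coe_lt_coe.mp hlt)
        (lt_of_lt_of_le (by rw [← hk]; exact WithTop.coe_lt_top k) le_rfl) hk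
      exact ⟨m, hm.trans hw.le, hmmin⟩

include f in
/-- **A test curve through a point where a continuous map differs from its generic value.** Let `X`
be integral, locally of finite type over a field and finite-dimensional, and let `φ : X → Y` be a
continuous map to a `T₀`-space (e.g. the underlying map of a morphism of schemes) with
`φ x ≠ φ η_X` for some point `x`. Then there is a closed subvariety `W ⊆ X` of dimension one (an
integral curve, `Motives/ClosedSubvarietyOfPoint`) and a point `w ∈ W` with `φ w ≠ φ η_W`: the
restriction of `φ` to `W` is not constant. [folklore] -/
theorem exists_closedSubvariety_dim_eq_one_apply_ne {d : ℕ} (hd : height (⊤ : X) = d)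
    {Y : Type*} [TopologicalSpace Y] [T0Space Y] {φ : X → Y} (hφ : Continuous φ) {x : X}
    (hx : φ x ≠ φ ⊤) :
    ∃ (W : ClosedSubvariety X) (w : W.carrier), W.dim = 1 ∧ φ (W.ι.base w) ≠ φ W.genericPoint := by
  -- a closed point `P` below `x` with `φ P ≠ φ η`
  have hxfin : height x < ⊤ :=
    (Order.height_mono (le_top (a := x))).trans_lt (by rw [hd]; exact WithTop.coe_lt_top d)
  obtain ⟨P, hPx, hPmin⟩ := Order.exists_isMin_le_of_height_lt_top hxfin
  have hP : height P = 0 := Order.height_eq_zero.mpr hPmin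
  have hxP : x ⤳ P := Scheme.le_iff_specializes.mp hPx
  have hηx : (⊤ : X) ⤳ x := Scheme.le_iff_specializes.mp le_top
  have hPφ : φ P ≠ φ ⊤ := by
    intro hPφ
    apply hx
    have h1 : φ ⊤ ⤳ φ x := hηx.map hφ
    have h2 : φ x ⤳ φ ⊤ := by rw [← hPφ]; exact hxP.map hφ
    exact (h2.antisymm h1).eq
  -- `d ≥ 1` since `P ≠ η`
  have hd1 : 1 ≤ d := by
    have hPtop : P < ⊤ := by
      refine lt_of_le_not_ge le_top fun h => hPφ ?_
      have h1 : P ⤳ ⊤ := Scheme.le_iff_specializes.mp h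
      have h2 : (⊤ : X) ⤳ P := Scheme.le_iff_specializes.mp le_top
      rw [(h1.antisymm h2).eq]
    have := Order.height_strictMono hPtop (by rw [hP]; exact WithTop.coe_lt_top 0)
    rw [hP, hd] at this
    exact_mod_cast Order.one_le_iff_pos.mpr this
  -- the closed set `φ⁻¹ (closure {φ P})` misses `η`
  have hF : IsClosed (φ ⁻¹' closure {φ P}) := isClosed_closure.preimage hφ
  have htop : (⊤ : X) ∉ φ ⁻¹' closure {φ P} := by
    intro h
    apply hPφ
    have h1 : φ P ⤳ φ ⊤ := specializes_iff_mem_closure.mpr h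
    have h2 : φ ⊤ ⤳ φ P := (hηx.trans hxP).map hφ
    exact (h1.antisymm h2).eq
  obtain ⟨y, hy, hyP, hyF⟩ := exists_height_eq_one_specializes_notMem d hd1 f hd hF htop hP
  refine ⟨ClosedSubvariety.ofPoint X y, ClosedSubvariety.ofPointPt y hyP, ?_, ?_⟩
  · rw [ClosedSubvariety.dim_ofPoint, hy]
  · rw [ClosedSubvariety.genericPoint_ofPoint]
    change φ P ≠ φ y
    intro h
    apply hyF
    change φ y ∈ closure {φ P}
    rw [← h]
    exact subset_closure (Set.mem_singleton _)

end Scheme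

end Literature.AlgebraicGeometry.Motives
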